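import Mathlib
import HarnessLib
import Summits.AtomisticToContinuum.FouriersLaw.Theses.BoundaryEscapeDeficit

/-!
# Birth skeleton (BC3) for crux `BoundaryEscapeDeficit.HalfChainTailLaw`
(item `stmt-AtomisticToContinuum-12235`, crux rank 2 of route `route-AtomisticToContinuum-BoundaryEscapeDeficit`,
sub-problem `FouriersLaw`; registrar `planner-skel-stmt-AtomisticToContinuum-12235-0`, 2026-08-17)

Crux (FIXED, concluded BY NAME below). For `P = pinnedChain ω₂ lam β γ` (all `> 0`) and `T > 0` let
`K_M(u) = ∫ (p_0² − T) · P_u^{M,T,T}(p_0² − T) dμ_T^M` be the equilibrium autocorrelation of the boundary kinetic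
energy of the `M`-site chain with BOTH Langevin baths at `T` (constructed kernel `OscillatorChain.transitionKernel`,
Gibbs state `OscillatorChain.gibbsMeasure`) and `θ_M(t) = (γ/T²)∫_0^t K_M` its boundary thermalisation curve.
`HalfChainTailLaw`: `∃ c, C, t₀ > 0` (with `c, t₀ > 0`): for every `t ≥ t₀`, EVENTUALLY IN THE LENGTH `M`,
`c/√t ≤ 1 − θ_M(t) ≤ C/√t`.

## Line `birth` — HALF-LINE CURVE × (UPPER, LOWER): the crux transported to the honest half-line object

The crux is an `M`-uniform statement about finite chains. The line factors it through the single function of one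
real variable it is "about" — the boundary thermalisation curve `θ_∞(t) := lim_M θ_M(t)` of the HALF-INFINITE
chain with one bath (route support item `HalfChainLocality`, stmt-AtomisticToContinuum-12240) — and cuts the
two-sided law for `θ_∞` along its two physically distinct halves:

* `stub_halfLineLocality` (EXISTENCE OF THE HALF-LINE CURVE; size M, tree engines exist): for every `t ≥ 0` the
  limit `θ_∞(t) = lim_{M→∞} θ_M(t)` exists. VERBATIM the route's support item `HalfChainLocality`
  (stmt-AtomisticToContinuum-12240; `Iff.rfl`, see `stub_halfLineLocality_iff` below), currently being proved
  from finite-time locality of the anharmonic chain (light cone `ButtaMarchioro2016_thm22_chain_holds`,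
  `LanfordLebowitzLieb1977_thm*_chain_holds`, PROVED in tree) + convergence of the Gibbs window marginals
  (`Theorems/BoundaryEscapeDeficitHalfChainLocality*.lean`, landed helper files). Once item 12240 lands
  (`HalfChainLocality_holds`), this stub is discharged by definitional equality.
* `stub_tailUpperHalfLine` (COMPLETE BOUNDARY THERMALISATION OF THE HALF-LINE AT THE DIFFUSIVE RATE; size XL,
  the HARDEST): every pointwise limit curve `θ_∞` of `(θ_M)` on `t ≥ 0` satisfies `1 − θ_∞(t) ≤ C/√t` for
  `t ≥ t₀ > 0`. Reading: `1 − θ_∞(t) = J(t)/(γδ)` is the normalised energy current still entering the half-line a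
  time `t` after its bath was raised by `δ`; the stub says the half-line has NO BALLISTIC AND NO SUPERDIFFUSIVE
  intake channel (it contains the sum rule `θ_∞(∞) = 1`, FALSE at the harmonic corner `lam = β = 0`:
  RiederLebowitzLieb1967, Nakazawa1970 — so `lam, β > 0` are load-bearing here). Continuum shadow: the half-space
  effusivity law `1 − θ(0,t) ≈ √(κ c_v/π)/(γ√t)` (BarratChiaruttini2003).
* `stub_tailLowerHalfLine` (NO FASTER-THAN-DIFFUSIVE SATURATION; size L): every pointwise limit curve satisfies
  `c/√t ≤ 1 − θ_∞(t)` for `t ≥ t₀`, some `c > 0`: the boundary of the half-line does not finish thermalising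
  faster than the first-return rate of 1-D diffusion (an energy CONDUCTANCE FLOOR seen at the boundary: the
  intake is not choked off by localisation / breathers). TRUE in kind at the harmonic corner (there
  `1 − θ_∞(t) → 1 − θ_∞(∞) > 0`), which is exactly what separates it from the upper stub: the two stubs have
  different truth values on the integrable member, so neither is the other (or the crux) reworded.
* COMPOSITION `HalfChainTailLaw_of` (sorry-free; the seam is the real-analysis lemma
  `tailLaw_of_limitCurve_bounds`): choose the curve `θ_∞` by `stub_halfLineLocality`, get `(C, t₁)` and
  `(c, t₂)` from the two bounds, and pass back to finite `M` at each fixed `t ≥ max t₁ t₂` with the room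
  `ε = c/(2√t) > 0`: eventually in `M`, `|θ_M(t) − θ_∞(t)| < c/(2√t)`, whence
  `(c/2)/√t ≤ 1 − θ_M(t) ≤ (C + c/2)/√t`. Constants of the crux: `c' = c/2`, `C' = C + c/2`, `t₀' = max t₁ t₂`.

Conversely the crux together with `stub_halfLineLocality` gives both half-line bounds with the SAME constants
(limits preserve `≤`), so modulo the locality input the line is an honest TRANSFER of the crux to
`C⁺ = two-sided t^{-1/2} law for the one function θ_∞`, split into its two one-sided halves. Why easier: `θ_∞` is a
single function of `t` with no length parameter — the natural object of comparison / PDE (Robin half-space) /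
renewal arguments — and all `M`-uniformity bookkeeping is absorbed once by locality, for which the engines are
proved in tree.

Hardest stub: `stub_tailUpperHalfLine` (a diffusive spreading bound for the boundary intake of an anharmonic
half-line: exists for no anharmonic Hamiltonian chain in print, BonettoLebowitzReyBellet2000 §6.3; it is the open
normal-conduction problem seen through one boundary scalar). BC3 probes (`stub → HalfChainTailLaw`,
`stub → FouriersLaw` by `first | exact? | simpa | aesop`) fail for all three stubs (planner folder `bc/`, quoted in
`Lines/birth.md`).
Disproof used: none on file (`ledger crux ls stmt-AtomisticToContinuum-12235`: no workfiles before this one — no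
`Disproof.lean`, no `Negative/` lemma, 2026-08-17); negatives index (20 entries, 2 in FouriersLaw:
`OddCorrectorDecay`, `FarFieldGaussianity`) contains nothing of this shape. Every stub keeps the crux's full
hypothesis prefix (`ω₂, lam, β, γ, T > 0`) and the crux's `let`-bound `P`, `K`, `θ` VERBATIM.
-/

noncomputable section

namespace Summit.AtomisticToContinuum.FouriersLaw.Cruxes.HalfChainTailLaw

namespace Birth

open Filter Topology

/-! ## The three registered stubs (signatures spelled out over Literature declarations only) -/

/-- **stub 1 — `stub_halfLineLocality` (existence of the half-line boundary thermalisation curve).**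
For `pinnedChain ω₂ lam β γ` (all `> 0`) and `T > 0`: for every `t ≥ 0` the limit `θ_∞(t) = lim_{M→∞} θ_M(t)`
exists, `θ_M(t) = (γ/T²)∫_0^t K_M`. Verbatim the route support item `BoundaryEscapeDeficit.HalfChainLocality`
(stmt-AtomisticToContinuum-12240). Size M. -/
theorem stub_halfLineLocality :
    ∀ ω₂ lam β γ : ℝ, 0 < ω₂ → 0 < lam → 0 < β → 0 < γ → ∀ T : ℝ, 0 < T → (let P := Literature.MathematicalPhysics.KineticTheory.HeatConduction.pinnedChain ω₂ lam β γ; let K : ℕ → ℝ → ℝ := fun N u => if h : 0 < N then ∫ z, ((z.2 ⟨0, h⟩) ^ 2 - T) * (∫ y, ((y.2 ⟨0, h⟩) ^ 2 - T) ∂(P.transitionKernel N T T u.toNNReal z)) ∂(P.gibbsMeasure N T) else 0; let θ : ℕ → ℝ → ℝ := fun N t => γ / T ^ 2 * ∫ u in (0 : ℝ)..t, K N u; ∀ t : ℝ, 0 ≤ t → ∃ θinf : ℝ, Filter.Tendsto (fun M : ℕ => θ M t) Filter.atTop (nhds θinf)) := by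
  sorry

/-- **stub 2 — `stub_tailUpperHalfLine` (complete boundary thermalisation of the half-line at the diffusive
rate; the HARDEST stub).** For `pinnedChain ω₂ lam β γ` (all `> 0`) and `T > 0`: every pointwise limit curve
`θinf` of `M ↦ θ_M(t)` on `t ≥ 0` obeys `1 − θinf t ≤ C/√t` for all `t ≥ t₀`, for some `C` and `t₀ > 0`
(no ballistic and no superdiffusive intake channel; contains the sum rule `θ_∞(∞) = 1`). Size XL / open. -/
theorem stub_tailUpperHalfLine :
    ∀ ω₂ lam β γ : ℝ, 0 < ω₂ → 0 < lam → 0 < β → 0 < γ → ∀ T : ℝ, 0 < T → (let P := Literature.MathematicalPhysics.KineticTheory.HeatConduction.pinnedChain ω₂ lam β γ; let K : ℕ → ℝ → ℝ := fun N u => if h : 0 < N then ∫ z, ((z.2 ⟨0, h⟩) ^ 2 - T) * (∫ y, ((y.2 ⟨0, h⟩) ^ 2 - T) ∂(P.transitionKernel N T T u.toNNReal z)) ∂(P.gibbsMeasure N T) else 0; let θ : ℕ → ℝ → ℝ := fun N t => γ / T ^ 2 * ∫ u in (0 : ℝ)..t, K N u; ∀ θinf : ℝ → ℝ, (∀ t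 : ℝ, 0 ≤ t → Filter.Tendsto (fun M : ℕ => θ M t) Filter.atTop (nhds (θinf t))) → ∃ C t₀ : ℝ, 0 < t₀ ∧ ∀ t : ℝ, t₀ ≤ t → 1 - θinf t ≤ C / Real.sqrt t) := by
  sorry

/-- **stub 3 — `stub_tailLowerHalfLine` (no faster-than-diffusive saturation of the boundary).** For
`pinnedChain ω₂ lam β γ` (all `> 0`) and `T > 0`: every pointwise limit curve `θinf` of `M ↦ θ_M(t)` on `t ≥ 0`
obeys `c/√t ≤ 1 − θinf t` for all `t ≥ t₀`, for some `c > 0`, `t₀ > 0` (a conductance floor seen at the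
boundary; true in kind at the harmonic corner, where `1 − θ_∞(t) ↛ 0`). Size L / open. -/
theorem stub_tailLowerHalfLine :
    ∀ ω₂ lam β γ : ℝ, 0 < ω₂ → 0 < lam → 0 < β → 0 < γ → ∀ T : ℝ, 0 < T → (let P := Literature.MathematicalPhysics.KineticTheory.HeatConduction.pinnedChain ω₂ lam β γ; let K : ℕ → ℝ → ℝ := fun N u => if h : 0 < N then ∫ z, ((z.2 ⟨0, h⟩) ^ 2 - T) * (∫ y, ((y.2 ⟨0, h⟩) ^ 2 - T) ∂(P.transitionKernel N T T u.toNNReal z)) ∂(P.gibbsMeasure N T) else 0; let θ : ℕ → ℝ → ℝ := fun N t => γ / T ^ 2 * ∫ u in (0 : ℝ)..t, K N u; ∀ θinf : ℝ → ℝ, (∀ t : ℝ, 0 ≤ t → Filter.Tendsto (fun M : ℕ => θ M t) Filter.atTop (nhds (θinf t))) → ∃ c t₀ : ℝ, 0 < c ∧ 0 < t₀ ∧ ∀ t : ℝ, t₀ ≤ t → c / Real.sqrt t ≤ 1 - θinf t) := by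
  sorry

/-! ## Name-keyed statements of the three stubs

`Registered.stub_X : Prop` is the statement of `stub_X` VERBATIM under the registered stub's short name, so that
the native skeleton audit (`#h21_check_skeleton`: hypotheses admissible iff registered obligations / declared stubs
BY NAME) accepts `HalfChainTailLaw_of : Registered.stub_halfLineLocality → … → HalfChainTailLaw` (device of
`Cruxes/SubdiffusiveBondHeat/Lines/helfand-window-box-gk.lean`). The `example`s right after certify that each
alias IS the corresponding stub's type. -/
namespace Registered

/-- Statement of `stub_halfLineLocality`, keyed by the stub name. -/
abbrev stub_halfLineLocality : Prop :=
  ∀ ω₂ lam β γ : ℝ, 0 < ω₂ → 0 < lam → 0 < β → 0 < γ → ∀ T : ℝ, 0 < T → (let P := Literature.MathematicalPhysics.KineticTheory.HeatConduction.pinnedChain ω₂ lam β γ; let K : ℕ → ℝ → ℝ := fun N u => if h : 0 < N then ∫ z, ((z.2 ⟨0, h⟩) ^ 2 - T) * (∫ y, ((y.2 ⟨0, h⟩) ^ 2 - T) ∂(P.transitionKernel N T T u.toNNReal z)) ∂(P.gibbsMeasure N T) else 0; let θ : ℕ → ℝ → ℝ := fun N t => γ / T ^ 2 * ∫ u in (0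 : ℝ)..t, K N u; ∀ t : ℝ, 0 ≤ t → ∃ θinf : ℝ, Filter.Tendsto (fun M : ℕ => θ M t) Filter.atTop (nhds θinf))

/-- Statement of `stub_tailUpperHalfLine`, keyed by the stub name. -/
abbrev stub_tailUpperHalfLine : Prop :=
  ∀ ω₂ lam β γ : ℝ, 0 < ω₂ → 0 < lam → 0 < β → 0 < γ → ∀ T : ℝ, 0 < T → (let P := Literature.MathematicalPhysics.KineticTheory.HeatConduction.pinnedChain ω₂ lam β γ; let K : ℕ → ℝ → ℝ := fun N u => if h : 0 < N then ∫ z, ((z.2 ⟨0, h⟩) ^ 2 - T) * (∫ y, ((y.2 ⟨0, h⟩) ^ 2 - T) ∂(P.transitionKernel N T T u.toNNReal z)) ∂(P.gibbsMeasure N T) else 0; let θ : ℕ → ℝ → ℝ := fun N t => γ / T ^ 2 * ∫ u in (0 : ℝ)..t, K N u; ∀ θinf : ℝ → ℝ, (∀ t : ℝ, 0 ≤ t → Filter.Tendsto (fun M : ℕ => θ M t) Filter.atTop (nhds (θinf t))) → ∃ C t₀ : ℝ, 0 < t₀ ∧ ∀ t : ℝ, t₀ ≤ t → 1 - θinf t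 ≤ C / Real.sqrt t)

/-- Statement of `stub_tailLowerHalfLine`, keyed by the stub name. -/
abbrev stub_tailLowerHalfLine : Prop :=
  ∀ ω₂ lam β γ : ℝ, 0 < ω₂ → 0 < lam → 0 < β → 0 < γ → ∀ T : ℝ, 0 < T → (let P := Literature.MathematicalPhysics.KineticTheory.HeatConduction.pinnedChain ω₂ lam β γ; let K : ℕ → ℝ → ℝ := fun N u => if h : 0 < N then ∫ z, ((z.2 ⟨0, h⟩) ^ 2 - T) * (∫ y, ((y.2 ⟨0, h⟩) ^ 2 - T) ∂(P.transitionKernel N T T u.toNNReal z)) ∂(P.gibbsMeasure N T) else 0; let θ : ℕ → ℝ → ℝ := fun N t => γ / T ^ 2 * ∫ u in (0 : ℝ)..t, K N u; ∀ θinf : ℝ → ℝ, (∀ t : ℝ, 0 ≤ t → Filter.Tendsto (fun M : ℕ => θ M t) Filter.atTop (nhds (θinf t))) → ∃ c t₀ : ℝ, 0 < c ∧ 0 < t₀ ∧ ∀ t : ℝ, t₀ ≤ t → c / Real.sqrt t ≤ 1 - θinf t)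

end Registered

example : Registered.stub_halfLineLocality := stub_halfLineLocality
example : Registered.stub_tailUpperHalfLine := stub_tailUpperHalfLine
example : Registered.stub_tailLowerHalfLine := stub_tailLowerHalfLine

/-- Stub 1 IS the route's support item `HalfChainLocality` (stmt-AtomisticToContinuum-12240), definitionally. -/
theorem stub_halfLineLocality_iff :
    Registered.stub_halfLineLocality ↔
      _root_.Summit.AtomisticToContinuum.FouriersLaw.Theses.BoundaryEscapeDeficit.HalfChainLocality :=
  Iff.rfl

/-! ## The seam: a real-analysis lemma (sorry-free) -/

/-- **Back from the half-line curve to finite chains.** Let `θ : ℕ → ℝ → ℝ`. If `M ↦ θ M t` converges for every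
`t ≥ 0`, every pointwise limit curve is eventually `≤`-bounded below by `1 − C/√t` … precisely: if every limit
curve `θinf` satisfies `1 − θinf t ≤ C/√t` (`t ≥ t₁ > 0`) and `c/√t ≤ 1 − θinf t` (`t ≥ t₂ > 0`, `c > 0`), then for
every `t ≥ max t₁ t₂`, eventually in `M`, `(c/2)/√t ≤ 1 − θ M t ≤ (C + c/2)/√t` (room `ε = c/(2√t) > 0`). -/
theorem tailLaw_of_limitCurve_bounds (θ : ℕ → ℝ → ℝ)
    (hLoc : ∀ t : ℝ, 0 ≤ t → ∃ θinf : ℝ, Tendsto (fun M : ℕ => θ M t) atTop (nhds θinf))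
    (hUp : ∀ θinf : ℝ → ℝ, (∀ t : ℝ, 0 ≤ t → Tendsto (fun M : ℕ => θ M t) atTop (nhds (θinf t))) →
      ∃ C t₀ : ℝ, 0 < t₀ ∧ ∀ t : ℝ, t₀ ≤ t → 1 - θinf t ≤ C / Real.sqrt t)
    (hLow : ∀ θinf : ℝ → ℝ, (∀ t : ℝ, 0 ≤ t → Tendsto (fun M : ℕ => θ M t) atTop (nhds (θinf t))) →
      ∃ c t₀ : ℝ, 0 < c ∧ 0 < t₀ ∧ ∀ t : ℝ, t₀ ≤ t → c / Real.sqrt t ≤ 1 - θinf t) :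
    ∃ c C t₀ : ℝ, 0 < c ∧ 0 < t₀ ∧ ∀ t : ℝ, t₀ ≤ t → ∀ᶠ M : ℕ in atTop,
      c / Real.sqrt t ≤ 1 - θ M t ∧ 1 - θ M t ≤ C / Real.sqrt t := by
  classical
  -- the half-line curve (any choice of the pointwise limits; `0` off `t ≥ 0`)
  let θinf : ℝ → ℝ := fun t => if h : 0 ≤ t then Classical.choose (hLoc t h) else 0
  have hconv : ∀ t : ℝ, 0 ≤ t → Tendsto (fun M : ℕ => θ M t) atTop (nhds (θinf t)) := by
    intro t ht
    have hθ : θinf t = Classical.choose (hLoc t ht) := by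
      simp only [θinf, dif_pos ht]
    rw [hθ]
    exact Classical.choose_spec (hLoc t ht)
  obtain ⟨C, t₁, ht₁, hC⟩ := hUp θinf hconv
  obtain ⟨c, t₂, hc, ht₂, hcl⟩ := hLow θinf hconv
  refine ⟨c / 2, C + c / 2, max t₁ t₂, by positivity, lt_of_lt_of_le ht₂ (le_max_right _ _), ?_⟩
  intro t ht
  have ht₁t : t₁ ≤ t := le_trans (le_max_left _ _) ht
  have ht₂t : t₂ ≤ t := le_trans (le_max_right _ _) ht
  have htpos : 0 < t := lt_of_lt_of_le ht₂ ht₂t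
  have hsq : 0 < Real.sqrt t := Real.sqrt_pos.2 htpos
  have hε : 0 < c / 2 / Real.sqrt t := div_pos (by positivity) hsq
  have hlim := hconv t htpos.le
  -- eventually `θ M t` is within `c/(2√t)` of the limit value
  have hev_lt : ∀ᶠ M : ℕ in atTop, θ M t < θinf t + c / 2 / Real.sqrt t :=
    (tendsto_order.1 hlim).2 _ (by linarith)
  have hev_gt : ∀ᶠ M : ℕ in atTop, θinf t - c / 2 / Real.sqrt t < θ M t :=
    (tendsto_order.1 hlim).1 _ (by linarith)
  filter_upwards [hev_lt, hev_gt] with M hM₁ hM₂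
  have hup := hC t ht₁t
  have hlow := hcl t ht₂t
  have hsplit : c / Real.sqrt t = c / 2 / Real.sqrt t + c / 2 / Real.sqrt t := by ring
  have hadd : (C + c / 2) / Real.sqrt t = C / Real.sqrt t + c / 2 / Real.sqrt t := by ring
  constructor
  · rw [hsplit] at hlow
    linarith
  · rw [hadd]
    linarith

/-! ## The skeleton theorem — the crux BY NAME from the three registered stubs -/

/-- **`HalfChainTailLaw` from the three stubs** (sorry-free; hypotheses are the registered stub statements by
name, conclusion is the route decl `BoundaryEscapeDeficit.HalfChainTailLaw` by name). The `let`-bound `P`, `K`,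
`θ` of the stubs and of the crux are syntactically identical and are zeta-reduced by `dsimp only`; the seam is
`tailLaw_of_limitCurve_bounds`. -/
theorem HalfChainTailLaw_of (h₁ : Registered.stub_halfLineLocality) (h₂ : Registered.stub_tailUpperHalfLine)
    (h₃ : Registered.stub_tailLowerHalfLine) :
    _root_.Summit.AtomisticToContinuum.FouriersLaw.Theses.BoundaryEscapeDeficit.HalfChainTailLaw := by
  intro ω₂ lam β γ hω hl hβ hγ T hT
  have k₁ := h₁ ω₂ lam β γ hω hl hβ hγ T hT
  have k₂ := h₂ ω₂ lam β γ hω hl hβ hγ T hT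
  have k₃ := h₃ ω₂ lam β γ hω hl hβ hγ T hT
  dsimp only at k₁ k₂ k₃ ⊢
  exact tailLaw_of_limitCurve_bounds _ k₁ k₂ k₃

/-- The assembled skeleton: the crux from the three (sorried) stubs — a kernel check that the registered stub
signatures fit the hypotheses of `HalfChainTailLaw_of` exactly. -/
example : _root_.Summit.AtomisticToContinuum.FouriersLaw.Theses.BoundaryEscapeDeficit.HalfChainTailLaw :=
  HalfChainTailLaw_of stub_halfLineLocality stub_tailUpperHalfLine stub_tailLowerHalfLine

end Birth

end Summit.AtomisticToContinuum.FouriersLaw.Cruxes.HalfChainTailLaw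

end
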